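import Literature.RingTheory.HilbertSamuel.PsiSemicontinuity
import Literature.RingTheory.MvPolynomial.HomogeneousDimension
import Literature.AlgebraicGeometry.Resolution.RegularLocalRingsQuotient
import Literature.AlgebraicGeometry.Resolution.SmoothUniformizationProofs
import Mathlib.RingTheory.RingHom.Flat
import Mathlib.RingTheory.TensorProduct.Quotient
import HarnessLib

/-!
# [OURS · L1 W4.2] D14 ROUTE H — object H8, algebra half: the ψ-SHIFT `ψ(B_Q) = ψ(A_q) + d`

Corridor-3 W-ladder (crux `SigmaMaxModifications`, stmt-ResolutionOfSingularities-18506 / conjunct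
stmt-ResolutionOfSingularities-19249), D14 ROUTE H of res-L1-w42-lead-1 (`D14-BRIDGE-CUT.md`, row H8),
dealt to res-D-pv-010 by res-L1-w42-plan-1 (RULINGS v3.14-7). HELPER file (`--supports stmt-…-19249`): it
closes no item, asserts nothing of [Hironaka2017], imports no `Theses` file, introduces no definition.
Consumed by `…Corridor3WLadderIsolatedCompletion` (H8 proper: `H^N_{Spec Â}(𝔓) = H^N_{Spec A}(𝔓 ∩ A)` and
isolation in the `H^N`-maximal locus passing to the completion).

## What is proved

`minimalPrimesCodim_localization_eq_add` — the `ψ`-equality of CJS (2.13) in ring form. Let `A → B` be a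
FLAT homomorphism of CATENARY noetherian local rings such that every minimal prime `𝔮` of `B` contracts to
a minimal prime of `A` with `dim B/𝔮 = dim A/(𝔮 ∩ A)` (for `B = Â` and `A` with formally equidimensional
`A/𝔭`, `𝔭` minimal, this is `ringKrullDim_quotient_eq_of_mem_minimalPrimes_adicCompletion`). Then for
every prime `Q` of `B` over `q = Q ∩ A`, writing `d = dim (B_Q / q B_Q)` for the dimension of the fibre of
`A_q → B_Q`:

> **`ψ(B_Q) = ψ(A_q) + d`**, where `ψ(C) = min { dim C/𝔮 : 𝔮 minimal }` (`minimalPrimesCodim`).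

## Proof

(1) VALUE FORMULA: for a minimal prime `𝔮 ⊆ Q` of `B` with `𝔭 = 𝔮 ∩ A` (minimal, `⊆ q`), catenarity
gives `dim B/𝔮 = dim(B_Q/𝔮B_Q) + dim B/Q` and `dim A/𝔭 = dim(A_q/𝔭A_q) + dim A/q`
(`ringKrullDim_quotient_eq_add`), and `dim B/𝔮 = dim A/𝔭` by hypothesis. (2) DIMENSION IDENTITY
`dim A/q = dim B/Q + d`: for a minimal `𝔭₁ ⊆ q`, the quotient map `A_q/𝔭₁A_q → B_Q/𝔭₁B_Q` is flat and
local with the same closed fibre, so `dim B_Q/𝔭₁B_Q = dim A_q/𝔭₁A_q + d` (Matsumura Thm. 15.1,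
`ringKrullDim_eq_add_of_flat`); a minimal prime `𝔔₁` of `𝔭₁B_Q` realising this dimension contracts to
`𝔭₁A_q` (going down), is a minimal prime of `B_Q`, and comes from a minimal prime `𝔮₁ ⊆ Q` of `B` over `𝔭₁`
(CJS Lemma 2.30 (1), `under_mem_minimalPrimes_of_mem_minimalPrimes_localization`); feed it to (1).
(3) The two minima: realise `ψ(A_q)` at `𝔭'A_q`, go down from `Q` to a prime over `𝔭'` and further to a
minimal `𝔮` of `B` (necessarily over `𝔭'`), obtaining `ψ(B_Q) ≤ ψ(A_q) + d`; conversely realise `ψ(B_Q)`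
at `𝔮'B_Q` and contract, obtaining `ψ(A_q) + d ≤ ψ(B_Q)`.

Author: res-D-pv-010 (HIRONAKA-L D lane, W4.2).

## References

* V. Cossart, U. Jannsen, S. Saito, *Desingularization: invariants and strategy*, LNM 2270 (2020),
  Lemma 2.30 (1), Lemma 2.37 (2) ((2.13)), Claim 2.40. [CossartJannsenSaito2020]
* H. Matsumura, *Commutative Ring Theory* (1986), Thm. 15.1. [Matsumura1987]
-/

noncomputable section

set_option linter.dupNamespace false

open IsLocalRing
open Literature.AlgebraicGeometry.Resolution Literature.RingTheory.HilbertSamuel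

universe u

namespace Summit.ResolutionOfSingularities.ResolutionOfSingularities.Cruxes.SigmaMaxModifications.IdeasL1C4

section PsiShift

variable {A B : Type u} [CommRing A] [CommRing B] [Algebra A B] [IsNoetherianRing A] [IsNoetherianRing B]
  [IsLocalRing A] [IsLocalRing B]

/-- **ψ-SHIFT along a flat homomorphism of catenary local rings whose minimal primes descend with their
codimensions** (the `ψ`-equality of CJS (2.13), in ring form). Let `A → B` be flat, `A`, `B` catenary
noetherian local, and assume every minimal prime `𝔮` of `B` contracts to a minimal prime of `A` with
`dim B/𝔮 = dim A/(𝔮 ∩ A)` (for `B = Â` this is `ringKrullDim_quotient_eq_of_mem_minimalPrimes_adicCompletion`).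
Then for every prime `Q` of `B` over `q = Q ∩ A`, with `d = dim (B_Q / q B_Q)` the dimension of the fibre of
`A_q → B_Q`:  **`ψ(B_Q) = ψ(A_q) + d`**, where `ψ(C) = min {dim C/𝔮 : 𝔮 minimal}` (`minimalPrimesCodim`).
Proof: value formula `dim(B_Q/𝔮B_Q) + dim B/Q = dim(A_q/(𝔮∩A)A_q) + dim A/q` for the minimal `𝔮 ⊆ Q`
(catenarity), the identity `dim A/q = dim B/Q + d` (flat dimension formula for `A_q/𝔮₁A_q → B_Q/𝔮₁B_Q`,
`𝔮₁ ⊆ q` minimal, Matsumura Thm. 15.1, plus going down), and comparison of the two minima by contraction /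
going down. [OURS · L1 W4.2] [cite: CossartJannsenSaito2020, Lemma 2.37 (2), (2.13)]
[cite: Matsumura1987, Thm. 15.1] -/
theorem minimalPrimesCodim_localization_eq_add [Module.Flat A B]
    (hcatA : IsCatenaryRing A) (hcatB : IsCatenaryRing B)
    (hmin : ∀ 𝔮 ∈ minimalPrimes B, 𝔮.under A ∈ minimalPrimes A ∧ ringKrullDim (B ⧸ 𝔮) = ringKrullDim (A ⧸ 𝔮.under A))
    (Q : Ideal B) [Q.IsPrime] (q : Ideal A) [q.IsPrime] (hq : q = Q.comap (algebraMap A B)) {d : ℕ}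
    (hd : ringKrullDim (Localization.AtPrime Q ⧸
      (maximalIdeal (Localization.AtPrime q)).map (Localization.localRingHom q Q (algebraMap A B) hq)) = d) :
    minimalPrimesCodim (Localization.AtPrime Q) = minimalPrimesCodim (Localization.AtPrime q) + d := by
  classical
  subst hq
  set q : Ideal A := Q.comap (algebraMap A B) with hqdef
  set R := Localization.AtPrime q with hR
  set S := Localization.AtPrime Q with hS
  set φ : R →+* S := Localization.localRingHom q Q (algebraMap A B) rfl with hφ
  letI : Algebra R S := φ.toAlgebra
  haveI : IsLocalHom (algebraMap R S) := Localization.isLocalHom_localRingHom q Q (algebraMap A B) rfl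
  haveI : Module.Flat R S := by
    have hflat : (algebraMap A B).Flat := RingHom.flat_algebraMap_iff.mpr inferInstance
    exact hflat.localRingHom Q q rfl
  /- (1) THE VALUE FORMULA. For a minimal prime `𝔮 ⊆ Q` of `B` with `p := 𝔮 ∩ A` (minimal, `⊆ q`):
     `dim(S/𝔮S) + dim B/Q = dim(R/pR) + dim A/q`. -/
  obtain ⟨cB, hcB⟩ := exists_ringKrullDim_quotient_eq_nat B Q
  obtain ⟨cA, hcA⟩ := exists_ringKrullDim_quotient_eq_nat A q
  have hval : ∀ 𝔮 ∈ minimalPrimes B, 𝔮 ≤ Q → ∀ (X Y : ℕ),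
      ringKrullDim (S ⧸ 𝔮.map (algebraMap B S)) = X →
      ringKrullDim (R ⧸ (𝔮.under A).map (algebraMap A R)) = Y → X + cB = Y + cA := by
    intro 𝔮 h𝔮 h𝔮Q X Y hX hY
    haveI := h𝔮.1.1
    obtain ⟨hpmin, hdimeq⟩ := hmin 𝔮 h𝔮
    haveI := hpmin.1.1
    have hpq : 𝔮.under A ≤ q := fun a ha => by
      rw [hqdef, Ideal.mem_comap]; exact h𝔮Q ha
    have h1 := ringKrullDim_quotient_eq_add B Q hcatB h𝔮Q      -- dim B/𝔮 = X + cB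
    have h2 := ringKrullDim_quotient_eq_add A q hcatA hpq       -- dim A/p = Y + cA
    rw [hX, hcB] at h1
    rw [hY, hcA] at h2
    rw [h1, h2] at hdimeq
    have : ((X + cB : ℕ) : WithBot ℕ∞) = ((Y + cA : ℕ) : WithBot ℕ∞) := by
      push_cast; exact hdimeq
    exact_mod_cast this
  /- (2) KEY DIMENSION IDENTITY `cA = cB + d`, through ONE minimal prime `𝔮₁ ⊆ Q` lying over a minimal prime
     `p₁ ⊆ q` and of maximal codimension over `p₁ S` (flat dimension formula for `R/p₁R → S/p₁S` + going down). -/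
  obtain ⟨p₁, hp₁, hp₁q⟩ := Ideal.exists_minimalPrimes_le (show (⊥ : Ideal A) ≤ q from bot_le)
  haveI := hp₁.1.1
  -- the quotient algebra `R̄ := R/p₁R → S̄ := S/p₁S`
  have hdisj₁ : Disjoint (q.primeCompl : Set A) p₁ := by
    rw [Set.disjoint_left]; intro a ha ha'; exact ha (hp₁q ha')
  set I : Ideal R := p₁.map (algebraMap A R) with hI
  haveI hIprime : I.IsPrime := IsLocalization.isPrime_of_isPrime_disjoint q.primeCompl R p₁ hp₁.1.1 hdisj₁
  haveI : Nontrivial (R ⧸ I) := Ideal.Quotient.nontrivial_iff.mpr hIprime.ne_top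
  haveI : IsLocalRing (R ⧸ I) := IsLocalRing.of_surjective' (Ideal.Quotient.mk I) Ideal.Quotient.mk_surjective
  have hImax : I.map (algebraMap R S) ≤ maximalIdeal S :=
    (Ideal.map_mono (IsLocalRing.le_maximalIdeal hIprime.ne_top)).trans
      (((IsLocalRing.local_hom_TFAE (algebraMap R S)).out 0 2).mp ‹_›)
  have hIStop : I.map (algebraMap R S) ≠ ⊤ := fun h => (maximalIdeal.isMaximal S).ne_top (top_le_iff.mp (h ▸ hImax))
  haveI : Nontrivial (S ⧸ I.map (algebraMap R S)) := Ideal.Quotient.nontrivial_iff.mpr hIStop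
  haveI : IsLocalRing (S ⧸ I.map (algebraMap R S)) :=
    IsLocalRing.of_surjective' (Ideal.Quotient.mk _) Ideal.Quotient.mk_surjective
  haveI : Module.Flat (R ⧸ I) (S ⧸ I.map (algebraMap R S)) :=
    Module.Flat.of_linearEquiv (Algebra.TensorProduct.quotIdealMapEquivQuotTensor S I).toLinearEquiv
  have hcomp : (algebraMap (R ⧸ I) (S ⧸ I.map (algebraMap R S))).comp (Ideal.Quotient.mk I) =
      (Ideal.Quotient.mk (I.map (algebraMap R S))).comp (algebraMap R S) := by
    ext r; rfl
  haveI : IsLocalHom (algebraMap (R ⧸ I) (S ⧸ I.map (algebraMap R S))) := by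
    refine ((IsLocalRing.local_hom_TFAE _).out 2 0).mp ?_
    rw [maximalIdeal_quotient_eq_map I,
      Ideal.map_map (Ideal.Quotient.mk I) (algebraMap (R ⧸ I) (S ⧸ I.map (algebraMap R S))), hcomp,
      ← Ideal.map_map (algebraMap R S) (Ideal.Quotient.mk (I.map (algebraMap R S))),
      maximalIdeal_quotient_eq_map (I.map (algebraMap R S))]
    exact Ideal.map_mono (((IsLocalRing.local_hom_TFAE (algebraMap R S)).out 0 2).mp ‹_›)
  -- flat dimension formula: `dim S̄ = dim R̄ + dim (S̄ / 𝔪_R̄ S̄)`, and `S̄/𝔪_R̄ S̄ ≅ S/𝔪_R S` has dimension `d`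
  have hfib : ringKrullDim ((S ⧸ I.map (algebraMap R S)) ⧸
      (maximalIdeal (R ⧸ I)).map (algebraMap (R ⧸ I) (S ⧸ I.map (algebraMap R S)))) = d := by
    have heq : (maximalIdeal (R ⧸ I)).map (algebraMap (R ⧸ I) (S ⧸ I.map (algebraMap R S))) =
        ((maximalIdeal R).map (algebraMap R S)).map (Ideal.Quotient.mk (I.map (algebraMap R S))) := by
      rw [maximalIdeal_quotient_eq_map I,
        Ideal.map_map (Ideal.Quotient.mk I) (algebraMap (R ⧸ I) (S ⧸ I.map (algebraMap R S))),
        Ideal.map_map (algebraMap R S) (Ideal.Quotient.mk (I.map (algebraMap R S))), hcomp]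
    rw [heq, ← hd]
    have hle : I.map (algebraMap R S) ≤ (maximalIdeal R).map (algebraMap R S) :=
      Ideal.map_mono (IsLocalRing.le_maximalIdeal hIprime.ne_top)
    exact ringKrullDim_eq_of_ringEquiv (DoubleQuot.quotQuotEquivQuotOfLE hle)
  obtain ⟨Y₁, hY₁⟩ := exists_nat_cast_eq_ringKrullDim (R := R ⧸ I)
  have hdimS : ringKrullDim (S ⧸ I.map (algebraMap R S)) = ((Y₁ + d : ℕ) : WithBot ℕ∞) := by
    rw [ringKrullDim_eq_add_of_flat (R := R ⧸ I) (S := S ⧸ I.map (algebraMap R S)), hY₁, hfib]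
    push_cast; rfl
  -- a minimal prime `𝔮₁'` of `p₁ S` of maximal codimension; it is a minimal prime of `S` over `p₁ R`
  obtain ⟨𝔮₁', h𝔮₁', hX₁⟩ := Literature.RingTheory.MvPolynomial.exists_minimalPrimes_ringKrullDim_quotient_eq hdimS
  haveI := h𝔮₁'.1.1
  have hIS : I.map (algebraMap R S) ≤ 𝔮₁' := h𝔮₁'.1.2
  have hover : 𝔮₁'.under R = I := by
    -- going down along the flat `R → S`
    have hle : I ≤ 𝔮₁'.under R := Ideal.map_le_iff_le_comap.mp hIS
    haveI : (𝔮₁'.under R).IsPrime := Ideal.IsPrime.under R 𝔮₁'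
    haveI : 𝔮₁'.LiesOver (𝔮₁'.under R) := ⟨rfl⟩
    obtain ⟨P', hP'le, hP'prime, hP'over⟩ := Ideal.exists_ideal_le_liesOver_of_le (p := I) 𝔮₁' hle
    have hP'I : I.map (algebraMap R S) ≤ P' := by
      rw [Ideal.map_le_iff_le_comap, ← Ideal.under_def, ← hP'over.over]
    have : P' = 𝔮₁' := le_antisymm hP'le (h𝔮₁'.2 ⟨hP'prime, hP'I⟩ hP'le)
    rw [← this]; exact hP'over.over.symm
  have h𝔮₁'min : 𝔮₁' ∈ minimalPrimes S := by
    refine ⟨⟨‹_›, bot_le⟩, fun 𝔮₀ h𝔮₀ h𝔮₀le => ?_⟩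
    haveI := h𝔮₀.1
    -- `𝔮₀ ∩ R ⊆ p₁R` is a prime, `p₁R` minimal in `R` ⇒ `𝔮₀ ⊇ p₁S` ⇒ `𝔮₀ = 𝔮₁'`
    have hImin : I ∈ minimalPrimes R := by
      have h := IsLocalization.minimalPrimes_map q.primeCompl R (⊥ : Ideal A)
      rw [Ideal.map_bot] at h
      show I ∈ (⊥ : Ideal R).minimalPrimes
      rw [h, Set.mem_preimage, hI, IsLocalization.under_map_of_isPrime_disjoint q.primeCompl R hp₁.1.1 hdisj₁]
      exact hp₁
    have hunder : 𝔮₀.under R = I :=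
      le_antisymm (hover ▸ Ideal.comap_mono h𝔮₀le) (hImin.2 ⟨Ideal.IsPrime.under R 𝔮₀, bot_le⟩
        (hover ▸ Ideal.comap_mono h𝔮₀le))
    have h𝔮₀I : I.map (algebraMap R S) ≤ 𝔮₀ := by rw [Ideal.map_le_iff_le_comap, ← Ideal.under_def, hunder]
    exact h𝔮₁'.2 ⟨h𝔮₀.1, h𝔮₀I⟩ h𝔮₀le
  -- pull `𝔮₁'` back to a minimal prime `𝔮₁ ⊆ Q` of `B`
  obtain ⟨h𝔮₁min, h𝔮₁Q, h𝔮₁map⟩ := under_mem_minimalPrimes_of_mem_minimalPrimes_localization B Q h𝔮₁'min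
  set 𝔮₁ := 𝔮₁'.under B with h𝔮₁
  haveI := h𝔮₁min.1.1
  -- its contraction to `A` is `p₁`
  have hp₁eq : 𝔮₁.under A = p₁ := by
    have h1 : 𝔮₁.under A = (𝔮₁'.under R).under A := by
      rw [h𝔮₁, Ideal.under_under, Ideal.under_under]
    rw [h1, hover, hI]
    exact IsLocalization.under_map_of_isPrime_disjoint q.primeCompl R hp₁.1.1 hdisj₁
  have hKD : cA = cB + d := by
    have := hval 𝔮₁ h𝔮₁min h𝔮₁Q (Y₁ + d) Y₁ (by rw [h𝔮₁map]; exact hX₁) (by rw [hp₁eq, ← hI]; exact hY₁)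
    omega
  /- (3) CONCLUSION: `ψ(S) = ψ(R) + d`, comparing the two minima through (1) + (2). -/
  show minimalPrimesCodim S = minimalPrimesCodim R + d
  apply le_antisymm
  · -- `ψ(S) ≤ ψ(R) + d`: realise `ψ(R)` at `p'`, go down to a minimal prime `𝔮 ⊆ Q` over `p = p' ∩ A`
    obtain ⟨p', hp', hp'dim⟩ := exists_minimalPrimes_ringKrullDim_eq_minimalPrimesCodim R
    obtain ⟨hpmin, hpq, hpmap⟩ := under_mem_minimalPrimes_of_mem_minimalPrimes_localization A q hp'
    set p := p'.under A with hp
    haveI := hpmin.1.1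
    haveI : Q.LiesOver q := ⟨rfl⟩
    obtain ⟨P, hPQ, hPprime, hPover⟩ := Ideal.exists_ideal_le_liesOver_of_le (p := p) Q hpq
    obtain ⟨𝔮, h𝔮, h𝔮P⟩ := Ideal.exists_minimalPrimes_le (show (⊥ : Ideal B) ≤ P from bot_le)
    haveI := h𝔮.1.1
    have h𝔮p : 𝔮.under A = p := by
      have hle : 𝔮.under A ≤ p := by rw [hPover.over]; exact Ideal.comap_mono h𝔮P
      exact le_antisymm hle (hpmin.2 ⟨Ideal.IsPrime.under A 𝔮, bot_le⟩ hle)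
    have h𝔮S : 𝔮.map (algebraMap B S) ∈ minimalPrimes S := by
      have h := IsLocalization.minimalPrimes_map Q.primeCompl S (⊥ : Ideal B)
      rw [Ideal.map_bot] at h
      show 𝔮.map (algebraMap B S) ∈ (⊥ : Ideal S).minimalPrimes
      rw [h, Set.mem_preimage, IsLocalization.under_map_of_isPrime_disjoint Q.primeCompl S h𝔮.1.1
        (by rw [Set.disjoint_left]; intro b hb hb'; exact hb ((h𝔮P.trans hPQ) hb'))]
      exact h𝔮
    haveI := h𝔮S.1.1
    obtain ⟨X, hX⟩ := exists_ringKrullDim_quotient_eq_nat S (𝔮.map (algebraMap B S))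
    have hY : ringKrullDim (R ⧸ (𝔮.under A).map (algebraMap A R)) = (minimalPrimesCodim R : ℕ) := by
      rw [h𝔮p, hp, hpmap]; exact hp'dim
    have := hval 𝔮 h𝔮 (h𝔮P.trans hPQ) X _ hX hY
    have hle := minimalPrimesCodim_le S h𝔮S hX
    omega
  · -- `ψ(R) + d ≤ ψ(S)`: realise `ψ(S)` at `𝔮'`, contract to `A`
    obtain ⟨𝔮', h𝔮', h𝔮'dim⟩ := exists_minimalPrimes_ringKrullDim_eq_minimalPrimesCodim S
    obtain ⟨h𝔮min, h𝔮Q, h𝔮map⟩ := under_mem_minimalPrimes_of_mem_minimalPrimes_localization B Q h𝔮'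
    set 𝔮 := 𝔮'.under B with h𝔮
    haveI := h𝔮min.1.1
    obtain ⟨hpmin, -⟩ := hmin 𝔮 h𝔮min
    haveI := hpmin.1.1
    have hpq : 𝔮.under A ≤ q := fun a ha => by rw [hqdef, Ideal.mem_comap]; exact h𝔮Q ha
    have hpR : (𝔮.under A).map (algebraMap A R) ∈ minimalPrimes R := by
      have h := IsLocalization.minimalPrimes_map q.primeCompl R (⊥ : Ideal A)
      rw [Ideal.map_bot] at h
      show (𝔮.under A).map (algebraMap A R) ∈ (⊥ : Ideal R).minimalPrimes
      rw [h, Set.mem_preimage, IsLocalization.under_map_of_isPrime_disjoint q.primeCompl R hpmin.1.1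
        (by rw [Set.disjoint_left]; intro a ha ha'; exact ha (hpq ha'))]
      exact hpmin
    haveI := hpR.1.1
    obtain ⟨Y, hY⟩ := exists_ringKrullDim_quotient_eq_nat R ((𝔮.under A).map (algebraMap A R))
    have hX : ringKrullDim (S ⧸ 𝔮.map (algebraMap B S)) = (minimalPrimesCodim S : ℕ) := by
      rw [h𝔮map]; exact h𝔮'dim
    have := hval 𝔮 h𝔮min h𝔮Q _ Y hX hY
    have hle := minimalPrimesCodim_le R hpR hY
    omega

end PsiShift

end Summit.ResolutionOfSingularities.ResolutionOfSingularities.Cruxes.SigmaMaxModifications.IdeasL1C4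

end
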